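import Mathlib
import HarnessLib
import Summits.Ventures.LatticeQCDFlow.Scoring.GlivenkoCantelliSandwich

/-!
# The QUANTILE DENSITY: where the distribution function `F` has `F(q) = u ∈ (0,1)` and a positive
# derivative `f`, the lower quantile function `v ↦ q_F(v) = inf{x : v ≤ F(x)}` satisfies
# `q_F(u) = q` and is differentiable at `u` with derivative `1/f`

HONEST FRAMING: exact (Metropolis-corrected) sampling algorithms for lattice gauge theory;
figures of merit are autocorrelation/cost numbers at stated couplings and volumes; no
continuum-physics claim.

Venture `LatticeQCDFlow` (cell pub-lqcd), topic `Scoring`; FANOUT row 4 (`s0-u1-b`, rung S0-B).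
The asymptotic variance of a sample `u`-quantile is `u(1−u)/(n f(q)²)` and its plug-in error bar
estimates `1/f(q)`; this deterministic file identifies that target as the derivative of the
quantile function (Tukey's sparsity / Parzen's quantile-density function, NAMED ONLY — nothing is
cited as a fact): **`lowerQuantile_eq_of_hasDerivAt`** (`q_F(u) = q`: `F < u` strictly to the
left of `q`) and **`hasDerivAt_lowerQuantile`** (`q_F′(u) = 1/f`), both from the Galois connection
`q_F(v) ≤ b ↔ v ≤ F(b)` of `GlivenkoCantelliSandwich.cdf_quantile_spec` evaluated at the four
points `q ± (1 ± δ)|v − u|/f` and the first-order expansion of `F` at `q`.  Only differentiability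
of `F` AT `q` is assumed (no density elsewhere, atoms away from `q` allowed).  The sampling
companion — consistency of the spacing estimator of `1/f` and of the plug-in standard error — is
`Scoring/SampleQuantileStdErr`.  NEW WORK of the cell (our formalisation); no definition.

## Content (`F = cdf ρ`, any measure `ρ` on `ℝ` through Mathlib's `cdf`)

* **`lowerQuantile_eq_of_hasDerivAt`** — `inf{x : u ≤ F(x)} = q`;
* **`hasDerivAt_lowerQuantile`** — `HasDerivAt (fun v => inf{x : v ≤ F(x)}) (1/f) u`.

NOT CLAIMED: differentiability of the quantile function on an interval or higher derivatives;
the non-identifiable case `f = 0`; any number of ours re-scored.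
-/

noncomputable section

namespace Summit.Ventures.LatticeQCDFlow.Scoring.GlivenkoCantelli

open MeasureTheory ProbabilityTheory Filter Function
open scoped Topology

/-! ## The quantile and the quantile density at a point of positive derivative -/

section QuantileDensity

variable (ρ : Measure ℝ)

/-- If `F = cdf ρ` has `F(q) = u ∈ (0,1)` and a positive derivative at `q`, then `q` IS the lower
`u`-quantile: `inf{x : u ≤ F(x)} = q`. [ours] (`F < u` strictly to the left of `q`) -/
theorem lowerQuantile_eq_of_hasDerivAt {u q f : ℝ} (hu0 : 0 < u) (hu1 : u < 1)
    (hFq : cdf ρ q = u) (hder : HasDerivAt (cdf ρ) f q) (hf : 0 < f) :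
    sInf {x | u ≤ cdf ρ x} = q := by
  obtain ⟨hF1, -, hgal⟩ := cdf_quantile_spec ρ hu0 hu1
  have hle : sInf {x | u ≤ cdf ρ x} ≤ q := (hgal q).2 hFq.ge
  rcases hle.eq_or_lt with h | hlt
  · exact h
  exfalso
  have hlo := (hasDerivAt_iff_isLittleO.1 hder).def (show (0 : ℝ) < f / 2 by positivity)
  obtain ⟨η, hη, hηF⟩ := Metric.eventually_nhds_iff.1 hlo
  -- a point strictly between the quantile and `q`, within `η` of `q`
  set t : ℝ := min (q - sInf {x | u ≤ cdf ρ x}) (η / 2) with ht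
  have ht0 : 0 < t := lt_min (by linarith) (by positivity)
  have ht1 : t ≤ q - sInf {x | u ≤ cdf ρ x} := min_le_left _ _
  have ht2 : t < η := lt_of_le_of_lt (min_le_right _ _) (by linarith)
  have h := hηF (show dist (q - t) q < η by
    rw [Real.dist_eq, sub_sub_cancel_left, abs_neg, abs_of_pos ht0]; exact ht2)
  rw [hFq] at h
  simp only [sub_sub_cancel_left, smul_eq_mul, Real.norm_eq_abs, abs_neg, abs_of_pos ht0] at h
  -- `F(q − t) ≤ u − t f + (f/2) t < u`, but `F(q − t) ≥ F(quantile) ≥ u`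
  have hup : cdf ρ (q - t) < u := by
    have := (abs_le.1 h).2
    nlinarith
  have hmono : cdf ρ (sInf {x | u ≤ cdf ρ x}) ≤ cdf ρ (q - t) := monotone_cdf ρ (by linarith)
  linarith

/-- **THE QUANTILE DENSITY.**  If `F = cdf ρ` has `F(q) = u ∈ (0,1)` and derivative `f > 0` at
`q`, then the lower quantile function `v ↦ q_F(v) = inf{x : v ≤ F(x)}` is differentiable at `u`
with derivative `1/f` (Parzen's quantile-density / Tukey's sparsity function at `u`). [ours]
(the Galois connection `q_F(v) ≤ b ↔ v ≤ F(b)` at the points `q ± (1 ± δ)|v − u|/f`) -/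
theorem hasDerivAt_lowerQuantile {u q f : ℝ} (hu0 : 0 < u) (hu1 : u < 1) (hFq : cdf ρ q = u)
    (hder : HasDerivAt (cdf ρ) f q) (hf : 0 < f) :
    HasDerivAt (fun v => sInf {x | v ≤ cdf ρ x}) (1 / f) u := by
  have hQu : sInf {x | u ≤ cdf ρ x} = q := lowerQuantile_eq_of_hasDerivAt ρ hu0 hu1 hFq hder hf
  rw [hasDerivAt_iff_isLittleO, Asymptotics.isLittleO_iff]
  intro c hc
  -- the relative precision `δ`
  set δ : ℝ := min (1 / 2) (c * f) with hδdef
  have hδ0 : 0 < δ := lt_min (by norm_num) (mul_pos hc hf)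
  have hδ1 : δ ≤ 1 / 2 := min_le_left _ _
  have hδc : δ / f ≤ c := by
    rw [div_le_iff₀ hf]
    exact min_le_right _ _
  have hf0 : f ≠ 0 := hf.ne'
  -- first-order expansion of `F` at `q + (c'/f)·w`, `|c'| ≤ 2`, `0 < w < ηf/2`
  have hlo := (hasDerivAt_iff_isLittleO.1 hder).def (show (0 : ℝ) < δ * f / 8 by positivity)
  obtain ⟨η, hη, hηF⟩ := Metric.eventually_nhds_iff.1 hlo
  have hF : ∀ c' : ℝ, |c'| ≤ 2 → ∀ w : ℝ, 0 < w → w < η * f / 2 →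
      |cdf ρ (q + c' / f * w) - u - c' * w| ≤ δ * w / 4 := by
    intro c' hc' w hw0 hwη
    have hdist : dist (q + c' / f * w) q < η := by
      rw [Real.dist_eq, add_sub_cancel_left, abs_mul, abs_div, abs_of_pos hf, abs_of_pos hw0]
      calc |c'| / f * w ≤ 2 / f * w := by gcongr
        _ < 2 / f * (η * f / 2) := by gcongr
        _ = η := by field_simp
    have h := hηF hdist
    rw [hFq] at h
    simp only [add_sub_cancel_left, smul_eq_mul, Real.norm_eq_abs] at h
    have e1 : c' / f * w * f = c' * w := by field_simp
    rw [e1] at h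
    calc |cdf ρ (q + c' / f * w) - u - c' * w| ≤ δ * f / 8 * |c' / f * w| := h
      _ = δ * w / 8 * |c'| := by
          rw [abs_mul, abs_div, abs_of_pos hf, abs_of_pos hw0]
          field_simp
      _ ≤ δ * w / 8 * 2 := mul_le_mul_of_nonneg_left hc' (by positivity)
      _ = δ * w / 4 := by ring
  have hc1 : |1 + δ| ≤ 2 := by rw [abs_of_pos (by linarith)]; linarith
  have hc2 : |1 - δ| ≤ 2 := by rw [abs_of_pos (by linarith)]; linarith
  have hc3 : |-(1 - δ)| ≤ 2 := by rw [abs_neg]; exact hc2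
  have hc4 : |-(1 + δ)| ≤ 2 := by rw [abs_neg]; exact hc1
  -- the neighbourhood of `u`
  have hr : 0 < min (min u (1 - u)) (η * f / 2) :=
    lt_min (lt_min hu0 (by linarith)) (by positivity)
  refine Metric.eventually_nhds_iff.2 ⟨_, hr, fun v hv => ?_⟩
  rw [Real.dist_eq] at hv
  have hv1 : |v - u| < u := lt_of_lt_of_le hv ((min_le_left _ _).trans (min_le_left _ _))
  have hv2 : |v - u| < 1 - u := lt_of_lt_of_le hv ((min_le_left _ _).trans (min_le_right _ _))
  have hv3 : |v - u| < η * f / 2 := lt_of_lt_of_le hv (min_le_right _ _)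
  rw [hQu, smul_eq_mul, Real.norm_eq_abs, Real.norm_eq_abs]
  rcases lt_trichotomy v u with hvu | hvu | hvu
  · -- `v < u`
    have hw0 : 0 < u - v := by linarith
    have hvw : v - u = -(u - v) := by ring
    rw [hvw, abs_neg, abs_of_pos hw0] at hv1 hv2 hv3
    rw [hvw, abs_neg, abs_of_pos hw0]
    have hv0' : 0 < v := by linarith
    have hv1' : v < 1 := by linarith
    obtain ⟨-, -, hgal⟩ := cdf_quantile_spec ρ hv0' hv1'
    have e3 := abs_le.1 (hF (-(1 - δ)) hc3 (u - v) hw0 hv3)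
    have e4 := abs_le.1 (hF (-(1 + δ)) hc4 (u - v) hw0 hv3)
    have hx3 : -(1 - δ) * (u - v) = -(u - v) + δ * (u - v) := by ring
    have hx4 : -(1 + δ) * (u - v) = -(u - v) - δ * (u - v) := by ring
    have hδw : 0 < δ * (u - v) := by positivity
    have hQb : sInf {x | v ≤ cdf ρ x} ≤ q + -(1 - δ) / f * (u - v) :=
      (hgal _).2 (by linarith [e3.1])
    have hQa : q + -(1 + δ) / f * (u - v) < sInf {x | v ≤ cdf ρ x} := by
      by_contra hle
      have := (hgal _).1 (not_lt.1 hle)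
      linarith [e4.2]
    have eb : -(1 - δ) / f * (u - v) = -((u - v) * (1 / f)) + δ / f * (u - v) := by ring
    have ea : -(1 + δ) / f * (u - v) = -((u - v) * (1 / f)) - δ / f * (u - v) := by ring
    have hcw : δ / f * (u - v) ≤ c * (u - v) := mul_le_mul_of_nonneg_right hδc hw0.le
    rw [abs_le]
    constructor <;> linarith
  · -- `v = u`
    rw [hvu, hQu]
    simp
  · -- `u < v`
    have hw0 : 0 < v - u := by linarith
    rw [abs_of_pos hw0] at hv1 hv2 hv3
    rw [abs_of_pos hw0]
    have hv0' : 0 < v := by linarith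
    have hv1' : v < 1 := by linarith
    obtain ⟨-, -, hgal⟩ := cdf_quantile_spec ρ hv0' hv1'
    have e1 := abs_le.1 (hF (1 + δ) hc1 (v - u) hw0 hv3)
    have e2 := abs_le.1 (hF (1 - δ) hc2 (v - u) hw0 hv3)
    have hx1 : (1 + δ) * (v - u) = (v - u) + δ * (v - u) := by ring
    have hx2 : (1 - δ) * (v - u) = (v - u) - δ * (v - u) := by ring
    have hδw : 0 < δ * (v - u) := by positivity
    have hQb : sInf {x | v ≤ cdf ρ x} ≤ q + (1 + δ) / f * (v - u) :=
      (hgal _).2 (by linarith [e1.1])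
    have hQa : q + (1 - δ) / f * (v - u) < sInf {x | v ≤ cdf ρ x} := by
      by_contra hle
      have := (hgal _).1 (not_lt.1 hle)
      linarith [e2.2]
    have eb : (1 + δ) / f * (v - u) = (v - u) * (1 / f) + δ / f * (v - u) := by ring
    have ea : (1 - δ) / f * (v - u) = (v - u) * (1 / f) - δ / f * (v - u) := by ring
    have hcw : δ / f * (v - u) ≤ c * (v - u) := mul_le_mul_of_nonneg_right hδc hw0.le
    rw [abs_le]
    constructor <;> linarith

end QuantileDensity

end Summit.Ventures.LatticeQCDFlow.Scoring.GlivenkoCantelli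

end
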